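import Summits.AtomisticToContinuum.BoseEinsteinCondensation.Theorems.BECThomsonPrincipleGDTransferSeededPlainPairCostBdd
import Summits.AtomisticToContinuum.BoseEinsteinCondensation.Theorems.BECThomsonPrincipleGDTransferSeededTransportDefs
import Summits.AtomisticToContinuum.BoseEinsteinCondensation.Theorems.BECThomsonPrincipleGDTransferSeededWeightedWindowLaw
import Summits.AtomisticToContinuum.BoseEinsteinCondensation.Theorems.BECThomsonPrincipleGDTransferSeededBandFromWindow

/-!
# Route `BECThomsonPrinciple`, crux `GDTransfer` (stmt-AtomisticToContinuum-9482), line `seeded-continuity`: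
# stub `stub_bandEmptinessBdd` (skeleton v6) — Gaussian domination empties the middle band, BOUNDED MEASURABLE profiles

Closes the registered stub `stub_bandEmptinessBdd : Sig.stub_bandEmptinessBdd` of skeleton v6,
`GaussianDominationCan → ∀ v, IsRepulsiveFiniteRange v → IsBoundedProfile v → BandEmptiness v`: the landed plain-pair
dichotomy `gd_bandEmptiness` (`…SeededProjectedDichotomyClosed`, finite CONTINUOUS profiles) re-run with continuity of
the profile weakened to boundedness on `[0, ∞)`.  Continuity entered that chain only as integrability / Fubini
bookkeeping of the pair weight `X ↦ v^per(x_p − x_q)` against continuous states on the compact cell; parts 1–4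
(`…SeededPlainFormsBdd`, `…SeededPlainPairsBdd`, `…SeededPlainInteractionBdd`, `…SeededPlainPairCostBdd`) re-prove
exactly the continuity-consuming theorems for a bounded measurable pair weight (the one new analytic leaf being the
self-adjointness of the cell average `P_i` with one bounded measurable entry).  Here the glue: the plain pair is a
weighted witness family for every bounded admissible profile (`weightedFamily_of_plain_bdd`, verbatim
`weightedFamily_of_plain` over `plainPairAlgebra_bdd` + `plainPairCost_bdd`), and then, exactly as `projectedDichotomy_of`,
GD ⟶ `stub_chordVariation` (two-sided dual norm) ⟶ `stub_weightedWindowLaw` (weighted window bound) ⟶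
`stub_bandFromWindow` (counting) gives band emptiness — none of which mentions the profile's regularity.

References: KennedyLiebShastry1988 (IR bound ⇒ order); LSSY2005 §1.2, Thm 2.2, Ch. 5, App. A; arXiv:1211.2778 §2.
-/

noncomputable section

open MeasureTheory Filter
open scoped ENNReal NNReal

namespace Summit.AtomisticToContinuum.BoseEinsteinCondensation.Cruxes.GDTransfer.Seeded

open Literature.MathematicalPhysics.QuantumManyBody.BoseGas
open Summit.AtomisticToContinuum.BoseEinsteinCondensation.Theses.BECThomsonPrinciple
open Summit.AtomisticToContinuum.BoseEinsteinCondensation.Theorems.GaussianDominationCan.Negative (InWindow)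
open Summit.AtomisticToContinuum.BoseEinsteinCondensation.Cruxes.GDTransfer.DysonDressedWitness
  (IsDirection mass eform windowSum windowSum_zero stub_chordVariation)

/-- **The plain pair is a weighted witness family for every BOUNDED admissible profile** (glue; constants `ρ₁ = γ = 1`,
`N₁ = 0`, `R = R₀(1 + J²)(E₀ + 2)` with `J = M√ρ L/2π`, `δ = min δ_cost 1`, zero defect) — verbatim
`weightedFamily_of_plain` over `plainPairAlgebra_bdd` and `plainPairCost_bdd`. [folklore] -/
theorem weightedFamily_of_plain_bdd {v : ℝ → ℝ≥0∞} (hv : IsRepulsiveFiniteRange v) {B : ℝ}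
    (hB : ∀ r, 0 ≤ r → v r ≤ ENNReal.ofReal B) : WeightedWitnessFamilyFor v := by
  -- adapted from `weightedFamily_of_plain` (finite continuous profile)
  intro M hM
  obtain ⟨c₁, c₂, hc₁, hc₂, hSV⟩ := plainPairCost_bdd hv hB
  refine ⟨1, c₁, c₂, 1, one_pos, hc₁, hc₂, one_pos, 0, ?_⟩
  intro m _ L hL _ hE0
  obtain ⟨R₀, hR₀, hAd⟩ := plainPairAlgebra_bdd hv hB m hL
  obtain ⟨δ, hδ, hSVΨ⟩ := hSV m L hL hE0
  set Jr : ℝ := M * Real.sqrt (((m + 1 : ℕ) : ℝ) / L ^ 3) * L / (2 * Real.pi) with hJr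
  set E0r : ℝ := (periodicGroundStateEnergy v (m + 1) L).toReal with hE0r
  have hE0r0 : 0 ≤ E0r := ENNReal.toReal_nonneg
  have hE0eq : periodicGroundStateEnergy v (m + 1) L = ENNReal.ofReal E0r :=
    (ENNReal.ofReal_toReal hE0).symm
  set R : ℝ := R₀ * (1 + Jr ^ 2) * (E0r + 2) with hR
  have hRpos : 0 < R := by positivity
  have hR₀R : R₀ ≤ R := by
    have h1 : (1 : ℝ) ≤ (1 + Jr ^ 2) * (E0r + 2) := by nlinarith [sq_nonneg Jr, hE0r0]
    calc R₀ = R₀ * 1 := (mul_one _).symm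
      _ ≤ R₀ * ((1 + Jr ^ 2) * (E0r + 2)) := by gcongr
      _ = R := by rw [hR]; ring
  refine ⟨R, hRpos, min δ 1, lt_min hδ one_pos, ?_⟩
  intro Ψ hΨ
  have hΨδ : periodicEnergy v Ψ ≤ periodicGroundStateEnergy v (m + 1) L + δ :=
    hΨ.trans (add_le_add le_rfl (min_le_left _ _))
  have hΨ1 : periodicEnergy v Ψ + 1 ≤ ENNReal.ofReal (E0r + 2) := by
    calc periodicEnergy v Ψ + 1 ≤ periodicGroundStateEnergy v (m + 1) L + min δ 1 + 1 := by gcongr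
      _ ≤ ENNReal.ofReal E0r + 1 + 1 := by rw [hE0eq]; gcongr; exact min_le_right _ _
      _ = ENNReal.ofReal (E0r + 2) := by
          rw [add_assoc, ← one_add_one_eq_two, ENNReal.ofReal_add hE0r0 (by norm_num)]
          norm_num
  refine ⟨fun _ => 0, ?_, ?_⟩
  · rw [windowSum_zero]; exact bot_le
  · intro n _ hwin
    obtain ⟨hdirp, hdirm, h1, h2, h3, h4, h5, h6⟩ := hAd n Ψ
    have hnJ : ‖(fun j => (n j : ℝ))‖ ≤ Jr := by
      have hw : 2 * Real.pi * ‖(fun j => (n j : ℝ))‖ / L ≤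
          M * Real.sqrt (((m + 1 : ℕ) : ℝ) / L ^ 3) := hwin
      rw [div_le_iff₀ hL] at hw
      rw [hJr, le_div_iff₀ (by positivity)]
      linarith
    have heform : ∀ {e : ℝ≥0∞},
        e ≤ ENNReal.ofReal (R₀ * (1 + ‖(fun j => (n j : ℝ))‖ ^ 2)) * (periodicEnergy v Ψ + 1) →
          e ≤ ENNReal.ofReal R := by
      intro e he
      calc e ≤ ENNReal.ofReal (R₀ * (1 + ‖(fun j => (n j : ℝ))‖ ^ 2)) * (periodicEnergy v Ψ + 1) := he
        _ ≤ ENNReal.ofReal (R₀ * (1 + Jr ^ 2)) * ENNReal.ofReal (E0r + 2) := by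
            have h0 : 0 ≤ ‖(fun j => (n j : ℝ))‖ := norm_nonneg _
            gcongr
        _ = ENNReal.ofReal R := by
            rw [← ENNReal.ofReal_mul (by positivity), hR]
    refine ⟨_, _, hdirp, hdirm, h1.trans (ENNReal.ofReal_le_ofReal hR₀R),
      h2.trans (ENNReal.ofReal_le_ofReal hR₀R), heform h3, heform h4, hSVΨ Ψ hΨδ n, ?_, ?_⟩
    · simpa only [add_zero] using h5
    · simpa only [add_zero] using h6

/-- **Registered stub `stub_bandEmptinessBdd` (skeleton v6 of line `seeded-continuity`, crux `GDTransfer`,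
stmt-AtomisticToContinuum-9482)**: under Gaussian domination the middle band `θN ≤ n̂₀ < (1−β)N` of the `n̂₀`-law of
near-minimisers is empty, uniformly down the density scale, for every admissible BOUNDED (measurable, finite-range,
`v ≤ B` on `[0, ∞)`) pair potential — GD ⟶ two-sided dual norm (`stub_chordVariation`) ⟶ weighted window bound
(`stub_weightedWindowLaw` on the weighted witness family `weightedFamily_of_plain_bdd`) ⟶ band emptiness
(`stub_bandFromWindow`).  [folklore assembly] (KennedyLiebShastry1988; LSSY2005 Thm 2.2, App. A; arXiv:1211.2778 §2) -/
theorem stub_bandEmptinessBdd : Sig.stub_bandEmptinessBdd := by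
  intro hG v hv hb
  obtain ⟨B, hB⟩ := hb
  exact stub_bandFromWindow v hv
    (stub_weightedWindowLaw (stub_chordVariation hG) v hv (weightedFamily_of_plain_bdd hv hB))

end Summit.AtomisticToContinuum.BoseEinsteinCondensation.Cruxes.GDTransfer.Seeded

end
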